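import Summits.QuantumFields.YangMills.Theorems.SwapTwistTraceDefs
import Summits.QuantumFields.YangMills.Theorems.SlowBitWindowInsertionTraceSpectral
import HarnessLib

/-!
# Swap-twisted zero-flux thermal traces: the spectral representation `Z^S_phys(T) = Σ_k λ_k^T ⟨e_k, e_k ∘ S⟩`

Support module for the door `SwapTwistDeficit.TwistDoor` (stmt-QuantumFields-23318) of route `SwapTwistDeficit` (D-0145 LINE g10-B
of seat ym-idea-4; target `ThermalTraceWindow.SubFemtoFirstLevel`).  For the swap-twisted trace `TT.twistTrace L β T` (p662796: the
closed chain of `T` transfer kernels whose seam `U_{T-1} → S U_0` is glued through the spatial axis swap `S = configPerm (swap 0 1)`):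

* §1 `twistTraceSucc_integrand_eq`, `twistTraceSucc_eq_integral_iterate` — peeling the cycle at slice `0` (Literature
  `integral_cyclic_het_eq_foldr`): `Z^S(m+2) = ∫ (κ_P^[m+1] K_β^P(·, S x))(x) dx` (`K_β`-iterates = `K_β^P`-iterates on the physical seed);
* §2 `configPerm_swap_swap`, `twistTraceSucc_eq_insertOne` — the change of variables `x ↦ S x` (measure preserving involution) gives the
  ONE-BOND-INSERTION FORM `Z^S(m+2) = ∫∫ K_β^P(S x, y) (κ_P^[m] K_β^P(·, x))(y) dy dx` (bond `X(x,y) = K_β^P(Sx, y)`, i.e. `𝕏 = S ∘ A_P`);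
* §3 **`twistTrace_spectral`** — Literature `hasSum_integral_iterate_insert_one` along the Hilbert basis «complete physical eigenbasis `e_k` ⊕
  a basis of the orthogonal complement» and the exact eigen-equation `K_β e_k = λ_k e_k` give, for `β > 0` and `T ≥ 3`,
  `twistTrace L β T = Σ_k λ_k^T d_k` with the SWAP OVERLAPS `d_k = ∫ e_k (e_k ∘ S) ∈ [-1, 1]` (Cauchy–Schwarz, `l2_comp_configPerm`) and
  `d_0 = 1` (the vacuum is a raw vacuum, invariant under axis permutations: `rawVacuum_comp_configPerm`).  No joint eigenbasis of
  `(P K_β P, S)` is needed for the door.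

HONEST FRAMING: fixed-lattice transfer-matrix bookkeeping for an M-sized support item of a DRAFT line onto a RECORD rung (K2a); no
renormalisation-group content; nothing here bears on infinite volume, the continuum limit, a mass gap or Clay.
References: [cite: tHooft1979Flux]; [cite: MontvayMunster1994, (3.145)]; [cite: ReedSimonI1980, Thm. VI.23].
-/

set_option autoImplicit false

noncomputable section

open MeasureTheory Filter Topology Function
open Literature.MathematicalPhysics.QuantumFieldTheory
open Literature.MathematicalPhysics.QuantumLattice
open Literature.Analysis.OperatorTheory.YMMatrixModel
open Literature.Analysis.OperatorTheory
open scoped InnerProductSpace BigOperators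

namespace Summit.QuantumFields.YangMills.Theorems.FemtoTransferGap.TT

open Summit.QuantumFields.YangMills.Theorems.FemtoTransferGap
open Summit.QuantumFields.YangMills.Theorems.FemtoTransferGap.PhysL2

variable {L : ℕ} [NeZero L]

/-! ## §1 Peeling the swap-twisted cycle -/

/-- The integrand of `twistTraceSucc L β (m+1)` as a cyclic product of `m+1` bonds `K_β` and one bond `(x,y) ↦ K_β^P(x, S y)`.
[folklore] -/
theorem twistTraceSucc_integrand_eq (β : ℝ) (m : ℕ) (V : Fin (m + 2) → GaugeConfig 3 L SU2) :
    (∏ i : Fin (m + 1), transferKernel su2Rep β (V i.castSucc) (V i.succ)) *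
        physAvg (transferKernel su2Rep β (V (Fin.last (m + 1)))) (configPerm (Equiv.swap 0 1) (V 0)) =
      ∏ t : Fin (m + 2), (fun s : ℕ => if s = m + 1 then (fun x y => physKernel (L := L) β x (configPerm (Equiv.swap 0 1) y))
        else transferKernel su2Rep β) t (V t) (V (t + 1)) := by
  symm
  rw [Fin.prod_univ_castSucc]
  congr 1
  · refine Finset.prod_congr rfl fun i _ => ?_
    have hi : ((Fin.castSucc i : Fin (m + 2)) : ℕ) ≠ m + 1 := by
      rw [Fin.val_castSucc]; exact ne_of_lt i.isLt
    simp only [hi, if_false, Fin.coeSucc_eq_succ]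
  · simp only [Fin.val_last, if_true, Fin.last_add_one, physKernel]

/-- **`Z^S_phys(L, β, m+2) = ∫ (κ_P^[m+1] K_β^P(·, S x))(x) dx`**: the swap-twisted cycle peeled at slice `0`
(Literature `integral_cyclic_het_eq_foldr`); on the physical seed `K_β^P(·, S x)` the `K_β`- and `K_β^P`-iterates coincide.
[cite: MontvayMunster1994, (3.145)] [cite: tHooft1979Flux] -/
theorem twistTraceSucc_eq_integral_iterate (β : ℝ) (m : ℕ) :
    twistTraceSucc L β (m + 1) =
      ∫ x, ((fun f : GaugeConfig 3 L SU2 → ℝ => fun w => ∫ z, physKernel β w z * f z ∂configMeasure SU2 L)^[m + 1]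
        (fun z => physKernel β z (configPerm (Equiv.swap 0 1) x))) x ∂configMeasure SU2 L := by
  obtain ⟨M, -, hM⟩ := exists_abs_transferKernel_le (L := L) β
  set S := configPerm (G := SU2) (L := L) (Equiv.swap (0 : Fin 3) 1) with hSdef
  set κ : ℕ → GaugeConfig 3 L SU2 → GaugeConfig 3 L SU2 → ℝ := fun s => if s = m + 1 then (fun x y => physKernel (L := L) β x (S y))
    else transferKernel su2Rep β with hκdef
  have hKPS : Measurable (uncurry fun x y : GaugeConfig 3 L SU2 => physKernel (L := L) β x (S y)) := by
    have e : (uncurry fun x y : GaugeConfig 3 L SU2 => physKernel (L := L) β x (S y)) =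
        (uncurry fun x y : GaugeConfig 3 L SU2 => physKernel (L := L) β x y) ∘ (fun p => (p.1, S p.2)) := by
      funext p; rcases p with ⟨a, b⟩
      simp only [Function.uncurry_apply_pair, Function.comp_apply]
    rw [e]
    exact (stronglyMeasurable_physKernel (L := L) β).measurable.comp (measurable_fst.prodMk (S.measurable.comp measurable_snd))
  have hκ : ∀ t, Measurable (Function.uncurry (κ t)) := fun t => by
    by_cases ht : t = m + 1
    · simp only [hκdef, ht, if_true]; exact hKPS
    · simp only [hκdef, ht, if_false]; exact (stronglyMeasurable_transferKernel (L := L) β).measurable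
  have hC : ∀ t x y, ‖κ t x y‖ ≤ M := fun t x y => by
    rw [Real.norm_eq_abs]
    by_cases ht : t = m + 1
    · simp only [hκdef, ht, if_true]; exact abs_physKernel_le hM x _
    · simp only [hκdef, ht, if_false]; exact hM x y
  have h1 : twistTraceSucc L β (m + 1) =
      ∫ V : Fin (m + 2) → GaugeConfig 3 L SU2, ∏ t : Fin (m + 2), κ t (V t) (V (t + 1)) ∂(Measure.pi fun _ => configMeasure SU2 L) := by
    unfold twistTraceSucc
    refine integral_congr_ae (ae_of_all _ fun V => ?_)
    exact twistTraceSucc_integrand_eq β m V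
  have h2 := integral_cyclic_congr_fin (L := L) (show m + 2 = 1 + m + 1 by omega) κ (configMeasure SU2 L)
  have h3 := integral_cyclic_het_eq_foldr (ρ := configMeasure SU2 L) hκ hC m
  rw [h1, h2, h3]
  refine integral_congr_ae (ae_of_all _ fun x => ?_)
  dsimp only
  have hlast : κ (m + 1) = fun x y => physKernel (L := L) β x (S y) := by simp [hκdef]
  have h4 := foldr_op_eq_iterate_of_eq (ρ := configMeasure SU2 L) κ (transferKernel su2Rep β) (m + 1) 0
    (fun i hi => by simp [hκdef, Nat.ne_of_lt hi]) (fun w => κ (m + 1) w x)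
  simp only [Nat.add_zero] at h4
  rw [h4, hlast]
  dsimp only
  rw [(iterate_physKernelOp_eq hM (isPhys_physKernel_left hM (S x)) (m + 1)).1]

/-! ## §2 The one-bond-insertion form -/

omit [NeZero L] in
/-- The spatial axis swap is an involution on configurations. [folklore] -/
theorem configPerm_swap_swap (U : GaugeConfig 3 L SU2) :
    configPerm (Equiv.swap (0 : Fin 3) 1) (configPerm (Equiv.swap (0 : Fin 3) 1) U) = U := by
  funext e
  rcases e with ⟨x, i⟩
  simp only [configPerm_apply, Equiv.symm_swap, Equiv.swap_apply_self]
  refine congrArg U (Prod.ext (funext fun j => ?_) rfl)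
  simp only [sitePerm_apply, Equiv.symm_swap, Equiv.swap_apply_self]

/-- **One-bond-insertion form of the swap-twisted trace**: `Z^S_phys(L, β, m+2) = ∫∫ K_β^P(S x, y) (κ_P^[m] K_β^P(·, x))(y) dy dx` — the
left-hand side of Literature `hasSum_integral_iterate_insert_one` with the bond `X(x,y) = K_β^P(Sx, y)` (change of variables `x ↦ S x`).
[cite: tHooft1979Flux] [cite: ReedSimonI1980, Thm. VI.23] -/
theorem twistTraceSucc_eq_insertOne (β : ℝ) (m : ℕ) :
    twistTraceSucc L β (m + 1) = ∫ x, ∫ y, physKernel β (configPerm (Equiv.swap 0 1) x) y *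
      ((fun f : GaugeConfig 3 L SU2 → ℝ => fun w => ∫ z, physKernel β w z * f z ∂configMeasure SU2 L)^[m]
        (fun z => physKernel β z x)) y ∂configMeasure SU2 L ∂configMeasure SU2 L := by
  rw [twistTraceSucc_eq_integral_iterate β m]
  rw [← (measurePreserving_configPerm' (L := L) (Equiv.swap 0 1)).integral_comp' (f := configPerm (Equiv.swap 0 1))
    (fun x => ((fun f : GaugeConfig 3 L SU2 → ℝ => fun w => ∫ z, physKernel β w z * f z ∂configMeasure SU2 L)^[m + 1]
      (fun z => physKernel β z (configPerm (Equiv.swap 0 1) x))) x)]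
  refine integral_congr_ae (ae_of_all _ fun x => ?_)
  dsimp only
  rw [configPerm_swap_swap, Function.iterate_succ_apply']

/-! ## §3 The spectral representation -/

set_option maxHeartbeats 1600000 in
/-- **Spectral representation of the swap-twisted zero-flux thermal trace.**  For `β > 0` there is a sequence `e_k` of physical zero-flux
test functions — `l2`-orthonormal exact eigenfunctions `K_β e_k = λ_k e_k`, `λ_k = levelValue su2Rep L β k`, `e_0` invariant under axis
permutations — such that for every `T ≥ 3`, `twistTrace L β T = Σ_k λ_k^T d_k` with the swap overlaps `d_k = ∫ e_k (e_k ∘ S)`, `|d_k| ≤ 1`,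
`d_0 = 1` (`Tr_phys(S T^T) = Σ λ_k^T ⟨e_k, S e_k⟩`). [cite: tHooft1979Flux] [cite: ReedSimonI1980, Thm. VI.22–VI.23] -/
theorem twistTrace_spectral {β : ℝ} (hβ : 0 < β) :
    ∃ e : ℕ → (GaugeConfig 3 L SU2 → ℝ),
      (∀ k, IsPhys (e k)) ∧
      (∀ k l, l2 (e k) (e l) = if k = l then 1 else 0) ∧
      (∀ k, transferApply β (e k) = levelValue su2Rep L β k • e k) ∧
      (∀ (σ : Equiv.Perm (Fin 3)) (U : GaugeConfig 3 L SU2), e 0 (configPerm σ U) = e 0 U) ∧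
      (∀ k, |∫ U, e k U * e k (configPerm (Equiv.swap 0 1) U) ∂configMeasure SU2 L| ≤ 1) ∧
      (∫ U, e 0 U * e 0 (configPerm (Equiv.swap 0 1) U) ∂configMeasure SU2 L = 1) ∧
      ∀ T : ℕ, 3 ≤ T →
        HasSum (fun k : ℕ => levelValue su2Rep L β k ^ T * ∫ U, e k U * e k (configPerm (Equiv.swap 0 1) U) ∂configMeasure SU2 L)
          (twistTrace L β T) := by
  classical
  haveI : SecondCountableTopology SU2 := secondCountableTopology_su2
  haveI : Fact ((2 : ENNReal) ≠ ⊤) := ⟨ENNReal.ofNat_ne_top⟩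
  haveI : CompleteSpace (physL2 L) := isClosed_physL2.completeSpace_coe
  set S := configPerm (G := SU2) (L := L) (Equiv.swap (0 : Fin 3) 1) with hSdef
  obtain ⟨M0, -, hM0⟩ := exists_abs_transferKernel_le (L := L) β
  -- the two `L²` operators
  obtain ⟨A, hA, hsa, -⟩ := exists_transferOpL2 (L := L) β
  have hKP := stronglyMeasurable_physKernel (L := L) β
  have hCP : ∀ U V : GaugeConfig 3 L SU2, ‖physKernel β U V‖ ≤ M0 := fun U V => by
    rw [Real.norm_eq_abs]; exact abs_physKernel_le hM0 U V
  obtain ⟨AP, hAP⟩ := exists_kernelOp (μ := configMeasure SU2 L) hKP hCP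
  -- the honest physical eigen-sequence
  obtain ⟨e, hon, heig, -, hker⟩ := exists_isPhys_eigenseq (L := L) hβ
  set u : ℕ → Lp ℝ 2 (configMeasure SU2 L) := fun n => toL2 (e n) with hu
  have hu_on : Orthonormal ℝ u := by
    rw [orthonormal_iff_ite]
    intro i l
    rw [hu, inner_toL2]
    exact hon i l
  have hAe : ∀ k, A (u k) = levelValue su2Rep L β k • u k := fun k => by
    have h1 : transferOp β (e k) = levelValue su2Rep L β k • e k := Subtype.ext (by rw [coe_transferOp, heig k]; rfl)
    simp only [hu]
    rw [apply_toL2 hA, h1, map_smul]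
  have hkerA : ∀ x : Lp ℝ 2 (configMeasure SU2 L), x ∈ physL2 L → (∀ i, ⟪u i, x⟫_ℝ = 0) → A x = 0 := by
    intro x hx hx'
    have h0 := hker x hx hx'
    apply Lp.ext
    filter_upwards [hA x, Lp.coeFn_zero ℝ 2 (configMeasure SU2 L)] with U h1 h2
    rw [h1, h2, Pi.zero_apply, h0 U]
  -- the Hilbert basis «`u` ⊕ a Hilbert basis of the orthogonal complement of its closed span»
  set E : Submodule ℝ (Lp ℝ 2 (configMeasure SU2 L)) := (Submodule.span ℝ (Set.range u)).topologicalClosure with hE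
  have hu_mem : ∀ n, u n ∈ E := fun n => Submodule.le_topologicalClosure _ (Submodule.subset_span (Set.mem_range_self n))
  have hu_phys : ∀ n, u n ∈ physL2 L := fun n => toL2_mem_physL2 (e n)
  obtain ⟨w, c, hwc⟩ := exists_hilbertBasis ℝ (↥Eᗮ)
  have hc_on' : Orthonormal ℝ ((↑) : w → ↥Eᗮ) := hwc ▸ c.orthonormal
  haveI : Countable w := (hc_on'.countable_of_separableSpace (𝕜 := ℝ)).to_subtype
  have hc_on : Orthonormal ℝ (fun j : w => (((j : ↥Eᗮ)) : Lp ℝ 2 (configMeasure SU2 L))) :=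
    Eᗮ.subtypeₗᵢ.orthonormal_comp_iff.mpr hc_on'
  set v : ℕ ⊕ w → Lp ℝ 2 (configMeasure SU2 L) := Sum.elim u (fun j : w => ((j : ↥Eᗮ) : Lp ℝ 2 (configMeasure SU2 L))) with hvdef
  have hv : Orthonormal ℝ v := by
    rw [orthonormal_iff_ite]
    rintro (n | j) (n' | j')
    · simp only [hvdef, Sum.elim_inl, Sum.inl.injEq]
      exact (orthonormal_iff_ite.mp hu_on) n n'
    · simp only [hvdef, Sum.elim_inl, Sum.elim_inr, reduceCtorEq, if_false]
      exact Submodule.inner_right_of_mem_orthogonal (hu_mem n) (j' : ↥Eᗮ).2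
    · simp only [hvdef, Sum.elim_inl, Sum.elim_inr, reduceCtorEq, if_false]
      exact Submodule.inner_left_of_mem_orthogonal (hu_mem n') (j : ↥Eᗮ).2
    · simp only [hvdef, Sum.elim_inr, Sum.inr.injEq]
      exact (orthonormal_iff_ite.mp hc_on) j j'
  have hrange : Set.range u ⊆ Set.range v := by
    rintro _ ⟨n, rfl⟩; exact ⟨Sum.inl n, rfl⟩
  have hspan : (Submodule.span ℝ (Set.range v))ᗮ = ⊥ := by
    rw [Submodule.eq_bot_iff]
    intro y hy
    have hyv : ∀ i, ⟪v i, y⟫_ℝ = 0 := fun i =>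
      Submodule.inner_right_of_mem_orthogonal (Submodule.subset_span (Set.mem_range_self i)) hy
    have hyE : y ∈ Eᗮ := by
      rw [Submodule.mem_orthogonal]
      intro z hz
      have hS' : IsClosed {z : Lp ℝ 2 (configMeasure SU2 L) | ⟪z, y⟫_ℝ = 0} :=
        isClosed_eq (continuous_id.inner continuous_const) continuous_const
      have hsub : ((Submodule.span ℝ (Set.range u) : Submodule ℝ (Lp ℝ 2 (configMeasure SU2 L))) :
          Set (Lp ℝ 2 (configMeasure SU2 L))) ⊆ {z | ⟪z, y⟫_ℝ = 0} := fun z hz =>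
        Submodule.inner_right_of_mem_orthogonal (Submodule.span_mono hrange hz) hy
      have hz' : z ∈ closure ((Submodule.span ℝ (Set.range u) : Submodule ℝ (Lp ℝ 2 (configMeasure SU2 L))) :
          Set (Lp ℝ 2 (configMeasure SU2 L))) := by
        rw [← Submodule.topologicalClosure_coe]; exact hz
      exact closure_minimal hsub hS' hz'
    set y' : ↥Eᗮ := ⟨y, hyE⟩ with hy'
    have hc0 : ∀ j : w, ⟪c j, y'⟫_ℝ = 0 := fun j => by
      rw [show c j = (j : ↥Eᗮ) from congrFun hwc j, Submodule.coe_inner]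
      exact hyv (Sum.inr j)
    have hrepr : c.repr y' = 0 := by
      ext j
      rw [c.repr_apply_apply, hc0 j]
      rfl
    have hy'0 : y' = 0 := by simpa using congrArg c.repr.symm hrepr
    exact congrArg Subtype.val hy'0
  set b : HilbertBasis (ℕ ⊕ w) ℝ (Lp ℝ 2 (configMeasure SU2 L)) := HilbertBasis.mkOfOrthogonalEqBot hv hspan with hbdef
  have hb : ∀ i, b i = v i := fun i => by rw [hbdef, HilbertBasis.coe_mkOfOrthogonalEqBot]
  -- eigen-relations of the operator of `K_β^P` along `b`
  set lam : ℕ ⊕ w → ℝ := Sum.elim (fun k => levelValue su2Rep L β k) (fun _ => 0) with hlamdef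
  have hbAP : ∀ i, AP (b i) = lam i • b i := by
    intro i
    rw [hb]
    rcases i with n | j
    · simp only [hvdef, hlamdef, Sum.elim_inl]
      rw [kernelOpP_apply_of_mem_physL2 hM0 hA hAP (hu_phys n), hAe]
    · simp only [hvdef, hlamdef, Sum.elim_inr, zero_smul]
      set y : Lp ℝ 2 (configMeasure SU2 L) := ((j : ↥Eᗮ) : Lp ℝ 2 (configMeasure SU2 L)) with hydef
      have hyE : y ∈ Eᗮ := (j : ↥Eᗮ).2
      set y₁ : Lp ℝ 2 (configMeasure SU2 L) := (physL2 L).starProjection y with hy₁def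
      have hy₁ : y₁ ∈ physL2 L := Submodule.starProjection_apply_mem _ y
      have hy₂ : y - y₁ ∈ (physL2 L)ᗮ := Submodule.sub_starProjection_mem_orthogonal y
      have h1 : AP (y - y₁) = 0 := kernelOpP_apply_of_mem_orthogonal hM0 hAP hy₂
      have h2 : AP y₁ = A y₁ := kernelOpP_apply_of_mem_physL2 hM0 hA hAP hy₁
      have h3 : A y₁ = 0 := by
        refine hkerA y₁ hy₁ fun i => ?_
        have ha : ⟪u i, y⟫_ℝ = 0 := Submodule.inner_right_of_mem_orthogonal (hu_mem i) hyE
        have hb' : ⟪u i, y - y₁⟫_ℝ = 0 := Submodule.inner_right_of_mem_orthogonal (hu_phys i) hy₂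
        have hsplit : ⟪u i, y₁⟫_ℝ = ⟪u i, y⟫_ℝ - ⟪u i, y - y₁⟫_ℝ := by
          rw [← inner_sub_right, sub_sub_cancel]
        rw [hsplit, ha, hb', sub_zero]
      calc AP y = AP (y₁ + (y - y₁)) := by rw [add_sub_cancel]
        _ = AP y₁ + AP (y - y₁) := map_add _ _ _
        _ = 0 := by rw [h1, h2, h3, add_zero]
  -- the data of the conclusion
  set ef : ℕ → GaugeConfig 3 L SU2 → ℝ := fun k => ((e k : physSubmodule L) : GaugeConfig 3 L SU2 → ℝ) with hef
  have hef_phys : ∀ k, IsPhys (ef k) := fun k => isPhys_coe (e k)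
  have hu_ae : ∀ k, (u k : GaugeConfig 3 L SU2 → ℝ) =ᵐ[configMeasure SU2 L] ef k := fun k => coeFn_toL2 (e k)
  have hperm : ∀ (σ : Equiv.Perm (Fin 3)) (U : GaugeConfig 3 L SU2), ef 0 (configPerm σ U) = ef 0 U := fun σ U =>
    rawVacuum_comp_configPerm β (hef_phys 0) (heig 0) σ U
  -- the swap overlaps
  have hnorm : ∀ k, ∫ U, ef k U * ef k U ∂configMeasure SU2 L = 1 := fun k => by
    have := hon k k; simp only [if_true] at this; exact this
  have hd_le : ∀ k, |∫ U, ef k U * ef k (S U) ∂configMeasure SU2 L| ≤ 1 := fun k => by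
    have hS_phys : IsPhys fun U => ef k (S U) := (hef_phys k).comp_configPerm _
    have h1 : |∫ U, ef k U * ef k (S U) ∂configMeasure SU2 L| ≤ ∫ U, |ef k U * ef k (S U)| ∂configMeasure SU2 L :=
      abs_integral_le_integral_abs
    have h2 : ∫ U, |ef k U * ef k (S U)| ∂configMeasure SU2 L ≤ ∫ U, (ef k U * ef k U + ef k (S U) * ef k (S U)) / 2 ∂configMeasure SU2 L := by
      refine integral_mono_of_nonneg (ae_of_all _ fun U => abs_nonneg _) ?_ (ae_of_all _ fun U => ?_)
      · exact (((hef_phys k).integrable_mul (hef_phys k)).add (hS_phys.integrable_mul hS_phys)).div_const 2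
      · dsimp only
        rw [abs_mul]
        nlinarith [two_mul_le_add_sq (|ef k U|) (|ef k (S U)|), sq_abs (ef k U), sq_abs (ef k (S U))]
    have h3 : ∫ U, (ef k U * ef k U + ef k (S U) * ef k (S U)) / 2 ∂configMeasure SU2 L = 1 := by
      rw [integral_div, integral_add ((hef_phys k).integrable_mul (hef_phys k)) (hS_phys.integrable_mul hS_phys), hnorm k]
      have h4 : ∫ U, ef k (S U) * ef k (S U) ∂configMeasure SU2 L = 1 := by
        have h := l2_comp_configPerm (L := L) (Equiv.swap (0 : Fin 3) 1) (ef k) (ef k)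
        unfold l2 at h
        rw [h]; exact hnorm k
      rw [h4]; norm_num
    exact h1.trans (h2.trans h3.le)
  have hd0 : ∫ U, ef 0 U * ef 0 (S U) ∂configMeasure SU2 L = 1 := by
    rw [← hnorm 0]
    exact integral_congr_ae (ae_of_all _ fun U => by simp only [hSdef, hperm])
  refine ⟨ef, hef_phys, hon, heig, hperm, hd_le, hd0, fun T hT => ?_⟩
  -- the spectral sum for `T = m + 3`
  obtain ⟨m, rfl⟩ : ∃ m, T = m + 3 := ⟨T - 3, by omega⟩
  set X : GaugeConfig 3 L SU2 → GaugeConfig 3 L SU2 → ℝ := fun x y => physKernel β (S x) y with hXdef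
  have hX : StronglyMeasurable (uncurry X) := by
    have e1 : uncurry X = (uncurry fun x y : GaugeConfig 3 L SU2 => physKernel (L := L) β x y) ∘ (fun p => (S p.1, p.2)) := by
      funext p; rcases p with ⟨a, b⟩
      simp only [hXdef, Function.uncurry_apply_pair, Function.comp_apply]
    rw [e1]
    exact hKP.comp_measurable ((S.measurable.comp measurable_fst).prodMk measurable_snd)
  have hCX : ∀ x y, ‖X x y‖ ≤ M0 := fun x y => hCP _ _
  obtain ⟨Xop, hXop⟩ := exists_kernelOp (μ := configMeasure SU2 L) hX hCX
  have hmain := hasSum_integral_iterate_insert_one (μ := configMeasure SU2 L) (b := b) hKP hCP (physKernel_symm β) hAP hbAP hX hCX hXop m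
  have htw : twistTrace L β (m + 3) = ∫ x, ∫ y, X x y *
      ((fun f : GaugeConfig 3 L SU2 → ℝ => fun w => ∫ z, physKernel β w z * f z ∂configMeasure SU2 L)^[m + 1]
        (fun z => physKernel β z x)) y ∂configMeasure SU2 L ∂configMeasure SU2 L := by
    rw [twistTrace, show m + 3 - 1 = (m + 1) + 1 by omega, twistTraceSucc_eq_insertOne β (m + 1)]
  rw [← htw] at hmain
  -- the diagonal matrix elements: `⟪b (inl k), 𝕏 b (inl k)⟫ = λ_k d_k`
  have hdiag : ∀ k, ⟪b (Sum.inl k), Xop (b (Sum.inl k))⟫_ℝ =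
      levelValue su2Rep L β k * ∫ U, ef k U * ef k (S U) ∂configMeasure SU2 L := by
    intro k
    rw [inner_kernelOp_eq_integral hXop, hb]
    simp only [hvdef, Sum.elim_inl]
    have hin : ∀ x, ∫ y, X x y * (u k : GaugeConfig 3 L SU2 → ℝ) y ∂configMeasure SU2 L = levelValue su2Rep L β k * ef k (S x) := by
      intro x
      have h1 : ∫ y, X x y * (u k : GaugeConfig 3 L SU2 → ℝ) y ∂configMeasure SU2 L = ∫ y, X x y * ef k y ∂configMeasure SU2 L :=
        integral_congr_ae (by filter_upwards [hu_ae k] with y hy; rw [hy])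
      rw [h1]
      simp only [hXdef]
      rw [integral_physKernel_mul_of_isPhys hM0 (hef_phys k) (S x), ← transferApply_apply, heig k, Pi.smul_apply, smul_eq_mul]
    rw [← integral_const_mul]
    refine integral_congr_ae ?_
    filter_upwards [hu_ae k] with x hx
    rw [hx, hin x]; ring
  -- restrict to `ℕ`
  have h0 : ∀ i ∉ Set.range (Sum.inl : ℕ → ℕ ⊕ w), lam i ^ (m + 2) * ⟪b i, Xop (b i)⟫_ℝ = 0 := by
    rintro (n | j) hn
    · exact absurd (Set.mem_range_self n) hn
    · simp only [hlamdef, Sum.elim_inr]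
      rw [zero_pow (by omega), zero_mul]
  have h2 := (Function.Injective.hasSum_iff Sum.inl_injective h0).mpr hmain
  refine h2.congr_fun fun k => ?_
  simp only [Function.comp_apply, hlamdef, Sum.elim_inl, hdiag k]
  ring

end Summit.QuantumFields.YangMills.Theorems.FemtoTransferGap.TT

end
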